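import Mathlib
import Summits.QuantumFields.QCD.Theses.PauliWegnerSea
import Summits.QuantumFields.QCD.Theorems.PauliWegnerSeaPhaseQuenchedFlavourDecayPionSecondMomentOfCrux
import Literature.MathematicalPhysics.QuantumFieldTheory.QCDTimeReflection

/-!
# Stub `stub_doubletSecondMoment_of_luscher_twist` of line `crossing-split-integrability`
(crux `Summit.QuantumFields.QCD.Theses.PauliWegnerSea.PhaseQuenchedFlavourDecay`, item stmt-QuantumFields-9151)

**A CONDITIONAL reduction in the typed world.**  The open core of the crux is a volume- and
parameter-uniform bound on phase-quenched (`|det D|`-reweighted Wilson measure) moments of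
quark-propagator entries.  This file isolates, for the mass-degenerate doublet `N_f = 2`
(`m_0 = m_1 ≥ -1 + δ`, `β ≥ 0`), the `r = 1`, `ε = 1` slice — the phase-quenched SECOND moment
`⟨Σ_{a,i,b,j} |G_0((x,a,i),(y,b,j))|²⟩₊` of the flavour-`0` propagator `G = D⁻¹` between ANY two
sites — as a consequence of two transfer-matrix statements taken as HYPOTHESES (stated below as
`Prop`-valued definitions; they are NOT proved here, and — being conjectural statements this line
posits rather than published facts — they carry NO provenance tag, exactly as the line-vocabulary
precedent `NestedDissectionSeaCoerciveOfDiluteLineDefs.lean`; the theorem is conditional on them):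

* `LuscherPionBound` — a Lüscher-type operator-norm bound: the periodic-quark numerator
  `|∫ det D · ⟨(ψ̄_g γ₅ ψ_f)(x)(ψ̄_f γ₅ ψ_g)(y)⟩_F dμ_W|` is at most `K(N_f, δ)` times the
  ANTIPERIODIC phase-quenched partition function `∫ |det D^{AP}| dμ_W` (tree `diracMatrixAP`);
* `TwistCoherenceAt` — twist coherence at each parameter point: on all large tori
  `c₀(N_f, δ) ∫ |det D^{AP}| dμ_W ≤ ∫ |det D| dμ_W`.

`stub_doubletSecondMoment_of_luscher_twist : LuscherPionBound → TwistCoherenceAt → …`: the second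
moment is bounded by `Φ(δ) = K / c₀` for ALL pairs of sites, uniformly in `β ≥ 0`, in the masses
`≥ -1 + δ` and in the (large) volume.

Proof (bookkeeping over landed facts):
* for the doublet at equal masses `det D = d · d` with `d = det D_W(U, m_0, 1)` REAL
  (`det_diracMatrix`, `fermionDet_wilsonDirac_im_holds`), so `(|det D| : ℂ) = det D`
  (`ofReal_norm_det_diracMatrix_doublet`);
* the configuration-wise Wick identity `pionPair_fermiRatio_eq` (`…PionSecondMomentOfCrux.lean`)
  gives `det D · ⟨π π⟩_F = -(|det D| · X)` with `X = Σ |G_0|²` (`det_mul_pionPair_fermiRatio_doublet`),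
  hence `∫ det D ⟨π π⟩_F dμ_W = -(∫ |det D| X dμ_W : ℂ)` (`integral_neg`, `integral_complex_ofReal`);
* numerator `N = ∫ |det D| X dμ_W ≤ |N| ≤ K Z_AP` (Lüscher bound), denominator
  `∫ |det D| dμ_W ≥ c₀ Z_AP` (twist coherence) and `> 0` (`integral_norm_det_diracMatrix_pos_all`),
  so `⟨X⟩₊ = N / ∫ |det D| dμ_W ≤ K / c₀` (`qcdPhaseQuenchedExpect_eq_div`, `div_le_div_iff₀`;
  `qcdPhaseQuenchedExpect_le_div_of_luscher_twist`).

Sources: M. Lüscher, *Construction of a selfadjoint, strictly positive transfer matrix for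
Euclidean lattice gauge theories*, Comm. Math. Phys. 54 (1977) 283–292 (transfer matrix for Wilson
fermions, `κ < 1/6`); I. Montvay, G. Münster, *Quantum Fields on a Lattice* (CUP 1994), §4.1.3
(4.25) (Wick rule), §5.1.2 (5.16) (real quark determinant).  Not here: any proof of the two
hypotheses (this line's structural finding, crux NOTES c7 §1); the neighbouring stubs of the line.
-/

noncomputable section

namespace Summit.QuantumFields.QCD.Cruxes.PhaseQuenchedFlavourDecay.CrossingSplitIntegrability

open scoped BigOperators ComplexOrder
open MeasureTheory Filter
open Literature.MathematicalPhysics.QuantumFieldTheory Literature.MathematicalPhysics.QuantumLattice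
  Literature.Probability.LatticeModels

/-- **LuscherPionBound** (hypothesis; transfer-matrix operator bound, Lüscher 1977 / Smit §6.5, for the flavoured pseudoscalar
pair).  For masses `≥ −1 + δ` (`κ < 1/6`) and `β ≥ 0` there is `K(N_f, δ)` such that on every odd torus `2S+1`, for every pair of
sites `x, y` (any time separation): the PERIODIC-quark (twisted-trace) numerator
`|∫ det D(U) · ⟨(ψ̄_g γ₅ ψ_f)(x)(ψ̄_f γ₅ ψ_g)(y)⟩_F(U) dμ_W|` is at most `K ×` the ANTIPERIODIC phase-quenched partition function
`∫ |det D^{AP}(U)| dμ_W`.  Modulo Lüscher's theorem this is `|Tr((−1)^F 𝕋^{N−t} π̂ 𝕋^t π̂†)| ≤ ‖π̂‖² Tr 𝕋^N ≤ ‖π̂‖² ∫|det D^{AP}|`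
(`𝕋 ≥ 0` the one-step transfer matrix, tree `QCDTransferMatrix.lean`; equal-time quark insertions are CAR monomials conjugated by
`T̂_F^{±1/2}`, i.e. rotated by the one-particle matrices `A^{±1/2}`, `A = (m+4)(1 − κ·spatial hopping) ≥ m + 1`). Not proved here. -/
def LuscherPionBound : Prop :=
  ∀ (Nf : ℕ) (δ : ℝ), 0 < δ → ∃ K : ℝ, 0 ≤ K ∧ ∀ (f g : Fin Nf) (β : ℝ) (mq : Fin Nf → ℝ) (S : ℕ) (x y : TorusSite 4 (2 * S + 1)), 0 ≤ β → (∀ fl, -1 + δ ≤ mq fl) → ‖∫ U : GaugeConfig 4 (2 * S + 1) SU3, (diracMatrix U mq).det * (fermiIntegral (torusBilinear g f x x gammaFive 1 * torusBilinear f g y y gammaFive 1 * fermiBoltzmann U mq) / fermiIntegral (fermiBoltzmann U mq)) ∂(wilsonMeasure (fundamentalRep (Fin 3)) β)‖ ≤ K * ∫ U : GaugeConfig 4 (2 * S + 1) SU3, ‖(diracMatrixAP U mq).det‖ ∂(wilsonMeasure (fundamentalRep (Fin 3)) β)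

/-- **TwistCoherenceAt** (hypothesis; "twist coherence" at each lattice parameter point).  For masses `≥ −1 + δ`, `β ≥ 0` there is
`c₀(N_f, δ) > 0` such that at every `(β, mq)`, for all large tori, the periodic-quark phase-quenched partition function is at least
`c₀ ×` the antiperiodic one: `c₀ ∫|det D^{AP}| dμ_W ≤ ∫ |det D| dμ_W`.  For pairwise-degenerate flavours both weights are honest and
the ratio is `⟨(−1)^F⟩` of the transfer-matrix thermal state: the fermion-number-odd (odd baryon number) sector is thermally
suppressed in large volumes — a GAP-type statement in the `(−1)^F`-odd sector, volume threshold `S₀(β, mq)`. Not proved here. -/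
def TwistCoherenceAt : Prop :=
  ∀ (Nf : ℕ) (δ : ℝ), 0 < δ → ∃ c₀ : ℝ, 0 < c₀ ∧ ∀ (β : ℝ) (mq : Fin Nf → ℝ), 0 ≤ β → (∀ fl, -1 + δ ≤ mq fl) → ∃ S₀ : ℕ, ∀ S : ℕ, S₀ ≤ S → c₀ * ∫ U : GaugeConfig 4 (2 * S + 1) SU3, ‖(diracMatrixAP U mq).det‖ ∂(wilsonMeasure (fundamentalRep (Fin 3)) β) ≤ ∫ U : GaugeConfig 4 (2 * S + 1) SU3, ‖(diracMatrix U mq).det‖ ∂(wilsonMeasure (fundamentalRep (Fin 3)) β)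

/-- **The doublet determinant is non-negative.**  For the mass-degenerate doublet (`N_f = 2`,
`m_0 = m_1`) the Wilson determinant `det D = det D_W(U, m_0, 1) · det D_W(U, m_0, 1)`
(`det_diracMatrix`) is the square of a REAL number (γ₅-hermiticity,
`fermionDet_wilsonDirac_im_holds`; Montvay–Münster (5.16)), hence `(|det D| : ℂ) = det D`. -/
theorem ofReal_norm_det_diracMatrix_doublet {L : ℕ} [NeZero L] (U : GaugeConfig 4 L SU3)
    (mq : Fin 2 → ℝ) (h01 : mq 0 = mq 1) :
    ((‖(diracMatrix U mq).det‖ : ℝ) : ℂ) = (diracMatrix U mq).det := by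
  have hdim : (fermionDet (wilsonDirac (fundamentalRep (Fin 3)) U (mq 0) 1)).im = 0 := by
    simpa using fermionDet_wilsonDirac_im_holds (L := L) (fundamentalRep (Fin 3))
      (fun g => fundamentalRep_mem_unitaryGroup g) U (mq 0) 1
  have hdre : fermionDet (wilsonDirac (fundamentalRep (Fin 3)) U (mq 0) 1) =
      (((fermionDet (wilsonDirac (fundamentalRep (Fin 3)) U (mq 0) 1)).re : ℝ) : ℂ) := by
    exact Complex.ext (by simp) (by simp [hdim])
  have hdet : (diracMatrix U mq).det =
      fermionDet (wilsonDirac (fundamentalRep (Fin 3)) U (mq 0) 1) *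
        fermionDet (wilsonDirac (fundamentalRep (Fin 3)) U (mq 0) 1) := by
    rw [det_diracMatrix, Fin.prod_univ_two, ← h01]
  rw [hdet, hdre, ← Complex.ofReal_mul, Complex.norm_real, Real.norm_eq_abs, abs_mul_self]

/-- **The Wick identity for the doublet, multiplied by the determinant.**  For `N_f = 2`, `m_0 = m_1`,
in every gauge background and for every pair of sites `x, y`:
`det D · ⟨(ψ̄_1 γ₅ ψ_0)(x) (ψ̄_0 γ₅ ψ_1)(y)⟩_F = -(|det D| · Σ_{a,i,b,j} |G_0((x,a,i),(y,b,j))|²)` as complex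
numbers (`pionPair_fermiRatio_eq` and `ofReal_norm_det_diracMatrix_doublet`; both sides are the junk
value `0` when `det D = 0`). -/
theorem det_mul_pionPair_fermiRatio_doublet {L : ℕ} [NeZero L] (U : GaugeConfig 4 L SU3)
    (mq : Fin 2 → ℝ) (h01 : mq 0 = mq 1) (x y : TorusSite 4 L) :
    (diracMatrix U mq).det *
        (fermiIntegral (torusBilinear 1 0 x x gammaFive 1 * torusBilinear 0 1 y y gammaFive 1 *
            fermiBoltzmann U mq) / fermiIntegral (fermiBoltzmann U mq)) =
      -(((‖(diracMatrix U mq).det‖ *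
          ∑ a : Fin 3, ∑ i : Fin 4, ∑ b : Fin 3, ∑ j : Fin 4,
            ‖(diracMatrix U mq)⁻¹ (quarkEquiv ((0 : Fin 2), (x, a, i)))
              (quarkEquiv ((0 : Fin 2), (y, b, j)))‖ ^ (2 : ℕ) : ℝ)) : ℂ) := by
  rw [pionPair_fermiRatio_eq U mq (f := 0) (g := 1) (by decide) h01 x y, Complex.ofReal_mul,
    ofReal_norm_det_diracMatrix_doublet U mq h01, mul_neg]

/-- **The real-analysis kernel of the reduction.**  If configuration-wise `det D · R = -(|det D| · X)`,
the numerator `‖∫ det D · R dμ_W‖` is at most `K · Z` and the phase-quenched denominator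
`∫ |det D| dμ_W` is at least `c₀ · Z` (`K ≥ 0`, `c₀ > 0`), then `⟨X⟩₊ ≤ K / c₀`: indeed
`∫ det D · R dμ_W = -(∫ |det D| X dμ_W : ℂ)`, so `∫ |det D| X ≤ K Z`, while the denominator is
positive (`integral_norm_det_diracMatrix_pos_all`) and `≥ c₀ Z`. -/
theorem qcdPhaseQuenchedExpect_le_div_of_luscher_twist {Nf S : ℕ} (β : ℝ) (mq : Fin Nf → ℝ)
    (X : GaugeConfig 4 (2 * S + 1) SU3 → ℝ) (R : GaugeConfig 4 (2 * S + 1) SU3 → ℂ) {K c₀ Z : ℝ}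
    (hK : 0 ≤ K) (hc₀ : 0 < c₀)
    (hpt : ∀ U, (diracMatrix U mq).det * R U = -(((‖(diracMatrix U mq).det‖ * X U : ℝ)) : ℂ))
    (hL : ‖∫ U : GaugeConfig 4 (2 * S + 1) SU3, (diracMatrix U mq).det * R U
        ∂(wilsonMeasure (fundamentalRep (Fin 3)) β)‖ ≤ K * Z)
    (hT : c₀ * Z ≤ ∫ U : GaugeConfig 4 (2 * S + 1) SU3, ‖(diracMatrix U mq).det‖
        ∂(wilsonMeasure (fundamentalRep (Fin 3)) β)) :
    qcdPhaseQuenchedExpect β (2 * S + 1) mq X ≤ K / c₀ := by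
  rw [qcdPhaseQuenchedExpect_eq_div]
  have hDn := integral_norm_det_diracMatrix_pos_all (S := 2 * S + 1) β mq
  simp only [hpt] at hL
  rw [integral_neg, integral_complex_ofReal, norm_neg, Complex.norm_real, Real.norm_eq_abs] at hL
  rw [div_le_div_iff₀ hDn hc₀]
  calc (∫ U : GaugeConfig 4 (2 * S + 1) SU3, ‖(diracMatrix U mq).det‖ * X U
          ∂(wilsonMeasure (fundamentalRep (Fin 3)) β)) * c₀
      ≤ K * Z * c₀ := by exact mul_le_mul_of_nonneg_right ((le_abs_self _).trans hL) hc₀.le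
    _ = K * (c₀ * Z) := by ring
    _ ≤ K * ∫ U : GaugeConfig 4 (2 * S + 1) SU3, ‖(diracMatrix U mq).det‖
          ∂(wilsonMeasure (fundamentalRep (Fin 3)) β) := by exact mul_le_mul_of_nonneg_left hT hK

/-- stub r20-a `stub_doubletSecondMoment_of_luscher_twist` (additive; CONDITIONAL reduction in the TYPED world).  For the degenerate
doublet `N_f = 2`, `m_0 = m_1 ≥ −1 + δ`, `β ≥ 0`: `LuscherPionBound ∧ TwistCoherenceAt ⇒` the phase-quenched SECOND moment of the
propagator `⟨Σ_{a,i,b,j}|G_0((x,a,i),(y,b,j))|²⟩₊` is bounded by `Φ(δ) = K/c₀` for ALL pairs of sites, uniformly in `β ≥ 0`, in the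
mass `≥ −1 + δ` and in the (large) volume — the `r = 1, ε = 1` doublet slice of the open core's amplitude bound, with NO localisation
input.  Proof: `|det D| = det D ≥ 0` for the doublet (`det` real, a square), `|det D|·X = −Re(det D · ⟨π π⟩_F)` by the Wick identity
`pionPair_fermiRatio_eq`, numerator `≤ K Z_AP` (Lüscher), denominator `≥ c₀ Z_AP` (twist coherence); junk cases give `0`. -/
theorem stub_doubletSecondMoment_of_luscher_twist :
    LuscherPionBound → TwistCoherenceAt → ∀ (δ : ℝ), 0 < δ → ∃ Φ : ℝ, ∀ (β : ℝ) (mq : Fin 2 → ℝ), 0 ≤ β → (∀ fl, -1 + δ ≤ mq fl) → mq 0 = mq 1 → ∃ S₀ : ℕ, ∀ S : ℕ, S₀ ≤ S → ∀ (x y : TorusSite 4 (2 * S + 1)), qcdPhaseQuenchedExpect β (2 * S + 1) mq (fun U : GaugeConfig 4 (2 * S + 1) SU3 => ∑ a : Fin 3, ∑ i : Fin 4, ∑ b : Fin 3, ∑ j : Fin 4, ‖(diracMatrix U mq)⁻¹ (quarkEquiv ((0 : Fin 2), (x, a, i))) (quarkEquiv ((0 : Fin 2), (y, b, j)))‖ ^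 (2 : ℕ)) ≤ Φ := by
  intro hLu hTw δ hδ
  obtain ⟨K, hK0, hK⟩ := hLu 2 δ hδ
  obtain ⟨c₀, hc₀, hc⟩ := hTw 2 δ hδ
  refine ⟨K / c₀, fun β mq hβ hm h01 => ?_⟩
  obtain ⟨S₀, hS₀⟩ := hc β mq hβ hm
  refine ⟨S₀, fun S hS x y => ?_⟩
  exact qcdPhaseQuenchedExpect_le_div_of_luscher_twist β mq _
    (fun U => fermiIntegral (torusBilinear 1 0 x x gammaFive 1 * torusBilinear 0 1 y y gammaFive 1 *
        fermiBoltzmann U mq) / fermiIntegral (fermiBoltzmann U mq))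
    hK0 hc₀ (fun U => det_mul_pionPair_fermiRatio_doublet U mq h01 x y) (hK 0 1 β mq S x y hβ hm)
    (hS₀ S hS)

end Summit.QuantumFields.QCD.Cruxes.PhaseQuenchedFlavourDecay.CrossingSplitIntegrability

end
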